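import Mathlib
import Summits.HodgeConjecture.CorCM.CM.Basic
import Literature.NumberTheory.ComplexMultiplication.InducedCMType
import HarnessLib

/-!
# The period types of a rank-four face are never induced from one proper CM subfield

Kernel certificate of the B01 lane's negative knowledge **N1 «flip does not commute with inflation»** (cell
pub-hodgecm2: `HOME/b01/ROUTES-B01.md` v2 §7 dead lines, `HOME/b01/IDEA-1-lens1.md` §3 N1; the sketch lemma
`face_psi_ne_induced` of `HOME/b01/IDEA-1-Sketch.lean` §4 carried a `sorry`, discharged here).

§1 (pure CM-type algebra over the tree's `inducedCMType` = Streng 2010 Ch. I Def. 3.2 and `CMTypeOps.flip`,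
`Φ^{(p)} = Φ ∆ {p, p̄}`).  For an embedding of number fields `k : K →+* M` that is NOT surjective and CM types
`Φ₀, Ψ₀` of `K`:
* `mem_inducedCMType_iff_of_comp_eq` — induced types `Φ₀^M = {τ | τ ∘ k ∈ Φ₀}` are saturated for «same restriction
  to `K`»;
* `exists_ne_comp_eq_of_not_surjective` — every `q : M →+* ℂ` has a companion `σ ≠ q` with `σ ∘ k = q ∘ k`
  (`#Hom_K(M, ℂ) = [M:K] ≥ 2`, Mathlib `AlgHom.card`; the device of the tree's
  `Literature.NumberTheory.ComplexMultiplication.exists_ne_of_inducedCMType`);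
* `flip_inducedCMType_ne_inducedCMType` — **`(Φ₀^M)^{(p)} ≠ Ψ₀^M`**: the member `q ∈ {p, p̄}` of `Φ₀^M` is not in
  `(Φ₀^M)^{(p)}`; its companion `σ ≠ q` lies in `Φ₀^M ∖ Ψ₀^M` by saturation, and
  `Φ₀^M ∖ (Φ₀^M ∆ {p, p̄}) ⊆ {p, p̄}`, so `σ = q̄ ∈ Φ₀^M` together with `q` — against the CM-type axiom.

§2 (faces).  For a rank-four face `f = (Φ; π, π′)` of `F` (`Face`, rfwf Def 1.1) the period quadruple
`f.psi = (Φ, Φ^{(ππ′)}, Φ^{(π)}, Φ^{(π′)})` has four slot pairs that differ by ONE flip — `(ψ₀,ψ₂)`, `(ψ₀,ψ₃)`,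
`(ψ₁,ψ₂)`, `(ψ₁,ψ₃)` — so no such pair, and a fortiori not the quadruple, is induced along one non-surjective
`k : K →+* F`: `Face.psi_zero_two_not_induced` (and three siblings), **`Face.psi_ne_induced`** (the sketch signature),
`Face.surjective_of_psi_eq_induced`, and the bundled-`CMField` spelling `face_psi_ne_induced`.

Reading for the junction B01 `PerLFace_of_PerL` (ROUTES-B01 §3 R4 (i) «at best Galois closures of sextics at ONE V»,
now «never», as a file:line): the inflation `(K, t) ↦ (F, t^F)` of a quadruple of CM types of a proper subfield
`K ⊊ F` — in particular of the stage-1 PerL quadruple `t¹…t⁴` of a sextic `K` — is never the period quadruple of a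
face of `F`; no route transfers the face period statement between CM fields by inducing types.  Slot pairs that differ
by TWO flips (`(ψ₀,ψ₁)`, `(ψ₂,ψ₃)`) are not excluded by this argument (a quadratic `F/K` can induce both).

Count-neutral (no BINDER-OWNERS row); theorems only; nothing here restates `PerL`, `PerLFace`, `PeriodThmF` or B01.
-/

noncomputable section

namespace Summit.HodgeConjecture.CorCM

open Literature.AlgebraicGeometry.Motives (CMType)
open Literature.NumberTheory.ComplexMultiplication
open Literature.NumberTheory.ComplexMultiplication.CMTypeOps
open NumberField NumberField.ComplexEmbedding
open scoped symmDiff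

/-! ## §1 Flip at one place does not commute with induction from a proper subfield -/

section Saturated

variable {K M : Type*} [Field K] [Field M]

/-- **Induced types are saturated for «same restriction»**: if `σ ∘ k = τ ∘ k` then `σ ∈ Φ₀^M ↔ τ ∈ Φ₀^M`
(membership in `Φ₀^M = {τ | τ ∘ k ∈ Φ₀}` is read on `K`). -/
theorem mem_inducedCMType_iff_of_comp_eq (k : K →+* M) (Φ₀ : CMType K) {σ τ : M →+* ℂ}
    (h : σ.comp k = τ.comp k) : σ ∈ (inducedCMType k Φ₀).1 ↔ τ ∈ (inducedCMType k Φ₀).1 := by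
  rw [mem_inducedCMType_iff, mem_inducedCMType_iff, h]

/-- The difference of two types induced along the same `k` is restriction-saturated: if `σ ∘ k = τ ∘ k` and
`σ ∈ Φ₀^M ∖ Ψ₀^M` then `τ ∈ Φ₀^M ∖ Ψ₀^M`. -/
theorem mem_diff_inducedCMType_of_comp_eq (k : K →+* M) (Φ₀ Ψ₀ : CMType K) {σ τ : M →+* ℂ}
    (h : σ.comp k = τ.comp k) (hσ : σ ∈ (inducedCMType k Φ₀).1 \ (inducedCMType k Ψ₀).1) :
    τ ∈ (inducedCMType k Φ₀).1 \ (inducedCMType k Ψ₀).1 :=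
  ⟨(mem_inducedCMType_iff_of_comp_eq k Φ₀ h).1 hσ.1,
    fun hτ => hσ.2 ((mem_inducedCMType_iff_of_comp_eq k Ψ₀ h).2 hτ)⟩

end Saturated

section Flip

variable {K M : Type} [Field K] [NumberField K] [Field M] [NumberField M]

/-- **A proper subfield sees every complex embedding at least twice.**  If `k : K →+* M` is not surjective, then
for every `q : M →+* ℂ` there is `σ : M →+* ℂ` with `σ ≠ q` and `σ ∘ k = q ∘ k`: the `K`-algebra maps `M → ℂ`
over `q ∘ k` number `[M:K]` (Mathlib `AlgHom.card`), and `[M:K] ≥ 2` because `[M:ℚ] = [K:ℚ]·[M:K]` with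
`[K:ℚ] < [M:ℚ]`. -/
theorem exists_ne_comp_eq_of_not_surjective (k : K →+* M) (hk : ¬ Function.Surjective k) (q : M →+* ℂ) :
    ∃ σ : M →+* ℂ, σ ≠ q ∧ σ.comp k = q.comp k := by
  classical
  letI : Algebra K M := k.toAlgebra
  letI : Algebra K ℂ := (q.comp k).toAlgebra
  -- `[K:ℚ] < [M:ℚ]`
  have hlt : Module.finrank ℚ K < Module.finrank ℚ M := by
    let k' : K →ₐ[ℚ] M := k.toRatAlgHom
    have hle : Module.finrank ℚ K ≤ Module.finrank ℚ M :=
      LinearMap.finrank_le_finrank_of_injective (f := k'.toLinearMap) k.injective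
    refine lt_of_le_of_ne hle fun heq ↦ hk ?_
    have hbij : Function.Bijective k'.toLinearMap :=
      ⟨k.injective, (LinearMap.injective_iff_surjective_of_finrank_eq_finrank heq).1 k.injective⟩
    exact hbij.2
  -- `[M:K] ≥ 2`
  have hmul := Module.finrank_mul_finrank ℚ K M
  have h2 : 1 < Module.finrank K M := by
    by_contra h
    have h1 : Module.finrank K M ≤ 1 := by omega
    have : Module.finrank ℚ M ≤ Module.finrank ℚ K := by
      rw [← hmul]
      calc Module.finrank ℚ K * Module.finrank K M ≤ Module.finrank ℚ K * 1 := Nat.mul_le_mul_left _ h1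
        _ = Module.finrank ℚ K := mul_one _
    omega
  -- two distinct `K`-embeddings over `q ∘ k`, one of them `q`
  have hcard : Fintype.card (M →ₐ[K] ℂ) = Module.finrank K M := AlgHom.card K M ℂ
  let q' : M →ₐ[K] ℂ := ⟨q, fun _ ↦ rfl⟩
  obtain ⟨t, ht⟩ := Fintype.exists_ne_of_one_lt_card (by rw [hcard]; exact h2) q'
  refine ⟨t.toRingHom, fun h ↦ ht (AlgHom.coe_ringHom_injective h), ?_⟩
  exact t.comp_algebraMap

/-- **Flipping an induced type at one place leaves the induced types.**  For `k : K →+* M` not surjective,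
`p : M →+* ℂ` and CM types `Φ₀, Ψ₀` of `K`: `(Φ₀^M)^{(p)} ≠ Ψ₀^M`.  Proof: let `q ∈ {p, p̄}` be the member lying
in `Φ₀^M`; then `q ∉ (Φ₀^M)^{(p)} = Ψ₀^M`.  A companion `σ ≠ q` with `σ ∘ k = q ∘ k`
(`exists_ne_comp_eq_of_not_surjective`) lies in `Φ₀^M ∖ Ψ₀^M` by saturation, and
`Φ₀^M ∖ (Φ₀^M ∆ {p, p̄}) ⊆ {p, p̄}`, so `σ = q̄` — but `q, q̄ ∈ Φ₀^M` contradicts the CM-type axiom. -/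
theorem flip_inducedCMType_ne_inducedCMType (k : K →+* M) (hk : ¬ Function.Surjective k) (p : M →+* ℂ)
    (Φ₀ Ψ₀ : CMType K) : flip p (inducedCMType k Φ₀) ≠ inducedCMType k Ψ₀ := by
  intro heq
  -- the member `q` of `{p, p̄}` lying in `Φ₀^M`
  obtain ⟨q, hqP, hqΦ⟩ : ∃ q ∈ placeSet p, q ∈ (inducedCMType k Φ₀).1 := by
    rcases mem_or_conjugate_mem (inducedCMType k Φ₀) p with h | h
    · exact ⟨p, by simp [placeSet], h⟩
    · exact ⟨conjugate p, by simp [placeSet], h⟩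
  -- `q ∉ Ψ₀^M = (Φ₀^M)^{(p)}`
  have hqΨ : q ∉ (inducedCMType k Ψ₀).1 := by
    rw [← heq, mem_flip_iff]
    tauto
  -- a companion `σ ≠ q` over `K`
  obtain ⟨σ, hσq, hσk⟩ := exists_ne_comp_eq_of_not_surjective k hk q
  have hσ : σ ∈ (inducedCMType k Φ₀).1 \ (inducedCMType k Ψ₀).1 :=
    mem_diff_inducedCMType_of_comp_eq k Φ₀ Ψ₀ hσk.symm ⟨hqΦ, hqΨ⟩
  -- hence `σ ∈ {p, p̄}`
  have hσP : σ ∈ placeSet p := by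
    have h2 := hσ.2
    rw [← heq, mem_flip_iff] at h2
    by_contra hP
    exact h2 (Or.inl ⟨hσ.1, hP⟩)
  -- `σ ≠ q`, both in `{p, p̄}`: `σ = q̄`
  have hσ_eq : σ = conjugate q := by
    simp only [placeSet, Set.mem_insert_iff, Set.mem_singleton_iff] at hσP hqP
    rcases hqP with rfl | rfl <;> rcases hσP with rfl | rfl
    · exact absurd rfl hσq
    · rfl
    · exact (involutive_conjugate M _).symm
    · exact absurd rfl hσq
  -- against the CM-type axiom for `Φ₀^M`
  rw [hσ_eq] at hσ
  exact (conjugate_mem_iff_notMem _ q).1 hσ.1 hqΦ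

/-- The symmetric reading: `Ψ₀^M ≠ (Φ₀^M)^{(p)}`. -/
theorem inducedCMType_ne_flip_inducedCMType (k : K →+* M) (hk : ¬ Function.Surjective k) (p : M →+* ℂ)
    (Φ₀ Ψ₀ : CMType K) : inducedCMType k Ψ₀ ≠ flip p (inducedCMType k Φ₀) :=
  fun h ↦ flip_inducedCMType_ne_inducedCMType k hk p Φ₀ Ψ₀ h.symm

/-- The same for a type `Φ` of `M` GIVEN as induced (`Φ = Φ₀^M`): `Φ^{(p)} ≠ Ψ₀^M` for every `Ψ₀` (consumer form:
`Φ = inducedCMType k Φ₀` is how a face presents an induced period type). -/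
theorem flip_ne_inducedCMType_of_eq_inducedCMType (k : K →+* M) (hk : ¬ Function.Surjective k) (p : M →+* ℂ)
    {Φ : CMType M} {Φ₀ : CMType K} (hΦ : Φ = inducedCMType k Φ₀) (Ψ₀ : CMType K) :
    flip p Φ ≠ inducedCMType k Ψ₀ := by
  rw [hΦ]
  exact flip_inducedCMType_ne_inducedCMType k hk p Φ₀ Ψ₀

/-- **No two types that differ by one flip are induced along the same proper `k`.**  If `Φ = Φ₀^M` and
`Φ^{(p)} = Ψ₀^M` then `k` is surjective (contrapositive packaging for consumers that carry `k` as data). -/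
theorem surjective_of_inducedCMType_of_flip_inducedCMType (k : K →+* M) (p : M →+* ℂ) {Φ : CMType M}
    {Φ₀ Ψ₀ : CMType K} (hΦ : Φ = inducedCMType k Φ₀) (hΨ : flip p Φ = inducedCMType k Ψ₀) :
    Function.Surjective k := by
  by_contra hk
  exact flip_ne_inducedCMType_of_eq_inducedCMType k hk p hΦ Ψ₀ hΨ

end Flip

/-! ## §2 Faces: adjacent period types differ by one flip -/

namespace Face

section Slots

variable {F : Type} [Field F]

/-- `ψ₀ = Φ`. -/
theorem psi_zero (f : Face F) : f.psi 0 = f.Φ := rfl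

/-- `ψ₁ = Φ^{(ππ′)}`. -/
theorem psi_one (f : Face F) : f.psi 1 = flip f.p' (flip f.p f.Φ) := rfl

/-- `ψ₂ = Φ^{(π)}`. -/
theorem psi_two (f : Face F) : f.psi 2 = flip f.p f.Φ := rfl

/-- `ψ₃ = Φ^{(π′)}`. -/
theorem psi_three (f : Face F) : f.psi 3 = flip f.p' f.Φ := rfl

/-- `ψ₂ = ψ₀^{(π)}`. -/
theorem psi_two_eq_flip_psi_zero (f : Face F) : f.psi 2 = flip f.p (f.psi 0) := rfl

/-- `ψ₃ = ψ₀^{(π′)}`. -/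
theorem psi_three_eq_flip_psi_zero (f : Face F) : f.psi 3 = flip f.p' (f.psi 0) := rfl

/-- `ψ₁ = ψ₂^{(π′)}`. -/
theorem psi_one_eq_flip_psi_two (f : Face F) : f.psi 1 = flip f.p' (f.psi 2) := rfl

/-- `ψ₁ = ψ₃^{(π)}` (two flips at different places commute: both are symmetric differences). -/
theorem psi_one_eq_flip_psi_three (f : Face F) : f.psi 1 = flip f.p (f.psi 3) := by
  apply Subtype.ext
  change (f.Φ.1 ∆ placeSet f.p) ∆ placeSet f.p' = (f.Φ.1 ∆ placeSet f.p') ∆ placeSet f.p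
  rw [symmDiff_assoc, symmDiff_assoc, symmDiff_comm (placeSet f.p)]

end Slots

section NotInduced

variable {F : Type} [Field F] [NumberField F] {K : Type} [Field K] [NumberField K]

/-- **Slots 0 and 2** (`Φ` and `Φ^{(π)}`) are never both induced along a non-surjective `k : K →+* F`. -/
theorem psi_zero_two_not_induced (f : Face F) (k : K →+* F) (hk : ¬ Function.Surjective k)
    (t₀ t₂ : CMType K) : ¬ (f.psi 0 = inducedCMType k t₀ ∧ f.psi 2 = inducedCMType k t₂) := fun h =>
  flip_ne_inducedCMType_of_eq_inducedCMType k hk f.p h.1 t₂ (f.psi_two_eq_flip_psi_zero ▸ h.2)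

/-- **Slots 0 and 3** (`Φ` and `Φ^{(π′)}`) are never both induced along a non-surjective `k`. -/
theorem psi_zero_three_not_induced (f : Face F) (k : K →+* F) (hk : ¬ Function.Surjective k)
    (t₀ t₃ : CMType K) : ¬ (f.psi 0 = inducedCMType k t₀ ∧ f.psi 3 = inducedCMType k t₃) := fun h =>
  flip_ne_inducedCMType_of_eq_inducedCMType k hk f.p' h.1 t₃ (f.psi_three_eq_flip_psi_zero ▸ h.2)

/-- **Slots 1 and 2** (`Φ^{(ππ′)}` and `Φ^{(π)}`) are never both induced along a non-surjective `k`. -/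
theorem psi_one_two_not_induced (f : Face F) (k : K →+* F) (hk : ¬ Function.Surjective k)
    (t₁ t₂ : CMType K) : ¬ (f.psi 1 = inducedCMType k t₁ ∧ f.psi 2 = inducedCMType k t₂) := fun h =>
  flip_ne_inducedCMType_of_eq_inducedCMType k hk f.p' h.2 t₁ (f.psi_one_eq_flip_psi_two ▸ h.1)

/-- **Slots 1 and 3** (`Φ^{(ππ′)}` and `Φ^{(π′)}`) are never both induced along a non-surjective `k`. -/
theorem psi_one_three_not_induced (f : Face F) (k : K →+* F) (hk : ¬ Function.Surjective k)
    (t₁ t₃ : CMType K) : ¬ (f.psi 1 = inducedCMType k t₁ ∧ f.psi 3 = inducedCMType k t₃) := fun h =>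
  flip_ne_inducedCMType_of_eq_inducedCMType k hk f.p h.2 t₁ (f.psi_one_eq_flip_psi_three ▸ h.1)

/-- **N1 — the period quadruple of a face is never induced from one proper CM subfield** (the sketch lemma
`face_psi_ne_induced` of the B01 ideation lens 1, its `sorry` discharged): for `k : K →+* F` not surjective and ANY
quadruple `t` of CM types of `K`, `f.psi ≠ (i ↦ (t i)^F)`.  Slots `0` and `2` already clash
(`psi_zero_two_not_induced`). -/
theorem psi_ne_induced (f : Face F) (k : K →+* F) (hk : ¬ Function.Surjective k) (t : Fin 4 → CMType K) :
    f.psi ≠ fun i => inducedCMType k (t i) := fun h =>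
  f.psi_zero_two_not_induced k hk (t 0) (t 2) ⟨congr_fun h 0, congr_fun h 2⟩

/-- Contrapositive packaging: if the period quadruple of a face of `F` is induced slotwise along ONE `k : K →+* F`,
then `k` is surjective (an isomorphism onto `F`). -/
theorem surjective_of_psi_eq_induced (f : Face F) (k : K →+* F) (t : Fin 4 → CMType K)
    (h : f.psi = fun i => inducedCMType k (t i)) : Function.Surjective k := by
  by_contra hk
  exact f.psi_ne_induced k hk t h

end NotInduced

end Face

/-- **N1 in the bundled-`CMField` currency of the route files** (`F K : CMField`, as `HOME/b01/IDEA-1-Sketch.lean` §4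
states it): the period quadruple `f.psi` of a rank-four face of `F` is not the slotwise induction along a
non-surjective `k : K →+* F` of any quadruple of CM types of `K`. -/
theorem face_psi_ne_induced (F : CMField) (f : Face F) (K : CMField) (k : K →+* F)
    (hk : ¬ Function.Surjective k) (t : Fin 4 → CMType K) :
    f.psi ≠ fun i => inducedCMType k (t i) :=
  f.psi_ne_induced k hk t

end Summit.HodgeConjecture.CorCM

end
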